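import Literature.Barriers.ResolutionOfSingularities.LocalMonomializationFailsClassA
import Literature.Barriers.ResolutionOfSingularities.LocalMonomializationFailsPersist
import HarnessLib

/-!
# Cutkosky's counterexample: no weak local monomialization (over the base field `F`)

`Literature/Barriers/ResolutionOfSingularities/LocalMonomializationFailsEndgame.lean` — the last
paragraph of the `n = 2` case of the proof of Theorem 1.4 (Cutkosky §3, p. 7), over an arbitrary
base field `F` of characteristic `p` with at least three elements, GRANTED the four named facts
`AbhyankarQuadraticFactorization` (Thm. 2.1), `AbhyankarQuadraticUnion` (Lemma 2.2),
`CutkoskyLemma31` (Lemma 3.1) and `CutkoskyMonomialPersists` (p. 7): if `A' → B'` were monomial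
with `ν*` dominating `B'`, `B'` dominating `A'`, `A'` dominating `A`, `B'` dominating `B`, then
`B' = B_l`, `A' = A_m` (the classifications), `l = pi + j` with `0 ≤ j < p`, `m ≤ pi` (by (C1) of
Lemma 3.1: `B_{pi+j}` dominates no quadratic transform of `A_{pi}`), and monomiality persists
along `A_m → ⋯ → A_{pi}`, contradicting (C4) of Lemma 3.1. PROVED:
`noWeakLocalMonomialization_F`. [cite: Cutkosky2014, §3 (p. 7) and Thm. 1.4]
-/

noncomputable section

namespace Literature.Barriers.ResolutionOfSingularities

namespace Cutkosky

open Literature.AlgebraicGeometry.Resolution IsLocalRing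
open scoped IntermediateField

universe u

variable {F : Type u} [Field F] {L : Type u} [Field L] [Algebra F L]

/-! ## Transport of monomiality along equal presentations -/

/-- Domination only depends on the two subalgebras. [folklore] -/
theorem dominates_congr {A₁ A₂ B₁ B₂ : Subalgebra F L} (hA : A₁ = A₂) (hB : B₁ = B₂)
    (h : Dominates F L A₁ B₁) : Dominates F L A₂ B₂ := by
  subst hA; subst hB; exact h

/-- Monomiality of an inclusion only depends on the two subalgebras. [folklore] -/
theorem isMonomialExtension_congr {A₁ A₂ B₁ B₂ : Subalgebra F L} (hA : A₁ = A₂) (hB : B₁ = B₂)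
    (h₁ : A₁ ≤ B₁) (h₂ : A₂ ≤ B₂)
    (h : @IsMonomialExtension A₁ B₁ _ _ (inclusionAlgebra h₁)) :
    @IsMonomialExtension A₂ B₂ _ _ (inclusionAlgebra h₂) := by
  subst hA; subst hB; exact h

/-- **The two consecutive rings of a block step, presented as a point and its blown-up point**:
for `j < p` there are `P, Q, γ` with `F[bCoord j]_{(…)} = F[P,Q]_{(P,Q)}` and
`F[bCoord (j+1)]_{(…)} = F[Q, P/Q − γ]_{(Q, P/Q − γ)}` (inside a block `γ = 0` and the coordinates
are swapped; at the end of the block `γ = α`). [cite: Cutkosky2014, Lemma 3.1] -/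
theorem exists_blowupPoint_presentation (p : ℕ) {P₀ Q₀ : L} (γ₀ : F) {j : ℕ} (hj : j < p)
    (h₁ : AlgebraicIndependent F (bCoord F L p P₀ Q₀ γ₀ j))
    (h₂ : AlgebraicIndependent F (bCoord F L p P₀ Q₀ γ₀ (j + 1))) :
    ∃ (P Q : L) (γ : F) (hPQ : AlgebraicIndependent F ![P, Q])
      (h' : AlgebraicIndependent F ![Q, P / Q - algebraMap F L γ]),
      originLocalRing h₁ = originLocalRing hPQ ∧ originLocalRing h₂ = originLocalRing h' := by
  have h₁' : AlgebraicIndependent F ![bCoord F L p P₀ Q₀ γ₀ j 0, bCoord F L p P₀ Q₀ γ₀ j 1] := by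
    rw [pair_eta]; exact h₁
  have e₁ : originLocalRing h₁ = originLocalRing h₁' := originLocalRing_congr h₁ h₁' (pair_eta _).symm
  rcases Nat.lt_or_ge (j + 1) p with hlt | hge
  · have hb := bCoord_succ_of_lt p (P := P₀) (Q := Q₀) γ₀ hlt
    have h₂' : AlgebraicIndependent F
        ![bCoord F L p P₀ Q₀ γ₀ j 0 / bCoord F L p P₀ Q₀ γ₀ j 1, bCoord F L p P₀ Q₀ γ₀ j 1] := by
      rw [← hb]; exact h₂
    have h₃' := algebraicIndependent_pair_swap h₂'
    have hfam : ![bCoord F L p P₀ Q₀ γ₀ j 1,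
        bCoord F L p P₀ Q₀ γ₀ j 0 / bCoord F L p P₀ Q₀ γ₀ j 1 - algebraMap F L 0] =
        ![bCoord F L p P₀ Q₀ γ₀ j 1, bCoord F L p P₀ Q₀ γ₀ j 0 / bCoord F L p P₀ Q₀ γ₀ j 1] := by
      rw [map_zero, sub_zero]
    have h₃ : AlgebraicIndependent F ![bCoord F L p P₀ Q₀ γ₀ j 1,
        bCoord F L p P₀ Q₀ γ₀ j 0 / bCoord F L p P₀ Q₀ γ₀ j 1 - algebraMap F L 0] := by
      rw [hfam]; exact h₃'
    refine ⟨_, _, 0, h₁', h₃, e₁, ?_⟩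
    rw [originLocalRing_congr h₂ h₂' hb, originLocalRing_swap h₂' h₃', originLocalRing_congr h₃' h₃ hfam.symm]
  · have hjp : j + 1 = p := le_antisymm hj hge
    have hb := bCoord_succ_of_eq p (P := P₀) (Q := Q₀) γ₀ hjp
    have h₃ : AlgebraicIndependent F ![bCoord F L p P₀ Q₀ γ₀ j 1,
        bCoord F L p P₀ Q₀ γ₀ j 0 / bCoord F L p P₀ Q₀ γ₀ j 1 - algebraMap F L γ₀] := by
      rw [← hb]; exact h₂
    exact ⟨_, _, γ₀, h₁', h₃, e₁, originLocalRing_congr h₂ h₃ hb⟩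

/-! ## The endgame -/

section Endgame

variable (p : ℕ) [hp : Fact p.Prime] [CharP F p] {x y : L} (hxy : AlgebraicIndependent F ![x, y])
  (hgen : IntermediateField.adjoin F {x, y} = ⊤)
  (h3 : ∃ a b c : F, a ≠ b ∧ b ≠ c ∧ a ≠ c) (hL : CutkoskyLemma31.{u})

/-- `A_k ⊆ B_l` with domination whenever `k ≤ pi` and `l = pi + j`. [cite: Cutkosky2014, §3 (p. 7)] -/
theorem Aring_dominated_Bring {k i j : ℕ} (hk : k ≤ p * i) :
    SubringDominates (Aring p hxy hgen h3 hL k).toSubring (Bring p hxy hgen h3 hL (p * i + j)).toSubring :=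
  ((Aring_dominates_of_le p hxy hgen h3 hL hk).trans
    ((dominates_iff_subringDominates _ _).mp (dominates_Aring_Bring p hxy hgen h3 hL i))).trans
    (Bring_dominates_of_le p hxy hgen h3 hL (Nat.le_add_right _ _))

/-- **Monomiality persists along `A_m → ⋯ → A_{pi}` inside `B_{pi+j}`** (granted
`CutkoskyMonomialPersists`): if `A_m → B_{pi+j}` is monomial and `m ≤ k ≤ pi` then `A_k → B_{pi+j}`
is monomial. [cite: Cutkosky2014, §3 (p. 7)] -/
theorem isMonomialExtension_persists (hP : CutkoskyMonomialPersists.{u}) {i j m : ℕ} (hmpi : m ≤ p * i)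
    (hmono : @IsMonomialExtension (Aring p hxy hgen h3 hL m) (Bring p hxy hgen h3 hL (p * i + j)) _ _
      (inclusionAlgebra (Aring_dominated_Bring p hxy hgen h3 hL (j := j) hmpi).1)) :
    ∀ k, m ≤ k → ∀ hk : k ≤ p * i,
      @IsMonomialExtension (Aring p hxy hgen h3 hL k) (Bring p hxy hgen h3 hL (p * i + j)) _ _
        (inclusionAlgebra (Aring_dominated_Bring p hxy hgen h3 hL (j := j) hk).1) := by
  haveI := isAlgebraic_Kuv F p hgen (x := x) (y := y)
  intro k hmk
  induction hmk with
  | refl => intro _; exact hmono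
  | @step k _ ih =>
    intro hk1
    have hk : k ≤ p * i := Nat.le_of_succ_le hk1
    have ihk := ih hk
    -- present `A_k` and `A_{k+1}` through the block they belong to
    have hkl : k = p * (k / p) + k % p := (Nat.div_add_mod k p).symm
    have hj' : k % p < p := Nat.mod_lt _ hp.out.pos
    have h₁ : AlgebraicIndependent F ((stage p hxy hgen h3 hL (k / p)).aFam h3 (k % p)) :=
      (stage p hxy hgen h3 hL (k / p)).algebraicIndependent_aFam h3 _
    have h₂ : AlgebraicIndependent F ((stage p hxy hgen h3 hL (k / p)).aFam h3 (k % p + 1)) :=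
      (stage p hxy hgen h3 hL (k / p)).algebraicIndependent_aFam h3 _
    have eA₁ : Aring p hxy hgen h3 hL k = originLocalRing h₁ := by
      rw [show Aring p hxy hgen h3 hL k = Aring p hxy hgen h3 hL (p * (k / p) + k % p) by rw [← hkl]]
      exact Aring_eq p hxy hgen h3 hL _ _ hj'.le h₁
    have eA₂ : Aring p hxy hgen h3 hL (k + 1) = originLocalRing h₂ := by
      rw [show Aring p hxy hgen h3 hL (k + 1) = Aring p hxy hgen h3 hL (p * (k / p) + (k % p + 1)) by
        rw [← add_assoc, ← hkl]]
      exact Aring_eq p hxy hgen h3 hL _ _ hj' h₂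
    obtain ⟨P, Q, γ, hPQ, h', e₁, e₂⟩ := exists_blowupPoint_presentation p _ hj' h₁ h₂
    have hz := algebraicIndependent_Bfam p hxy hgen h3 hL (p * i + j)
    have eB : Bring p hxy hgen h3 hL (p * i + j) = originLocalRing hz := rfl
    have hdomk1 : Dominates F L (Aring p hxy hgen h3 hL (k + 1)) (Bring p hxy hgen h3 hL (p * i + j)) :=
      Aring_dominated_Bring p hxy hgen h3 hL (j := j) hk1
    have hdomk : Dominates F L (Aring p hxy hgen h3 hL k) (Bring p hxy hgen h3 hL (p * i + j)) :=
      Aring_dominated_Bring p hxy hgen h3 hL (j := j) hk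
    have eA₁' : Aring p hxy hgen h3 hL k = originLocalRing hPQ := eA₁.trans e₁
    have eA₂' : Aring p hxy hgen h3 hL (k + 1) = originLocalRing h' := eA₂.trans e₂
    have hd1 : Dominates F L (originLocalRing h') (originLocalRing hz) := dominates_congr eA₂' eB hdomk1
    have hd0 : Dominates F L (originLocalRing hPQ) (originLocalRing hz) := dominates_congr eA₁' eB hdomk
    have hmono₀ := isMonomialExtension_congr eA₁' eB _ hd0.1 ihk
    have step := hP F L P Q hPQ γ h' _ hz hd1.1 hd1 hd0.1 hmono₀
    exact isMonomialExtension_congr eA₂'.symm eB.symm hd1.1 _ step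

/-- **No weak local monomialization along `ν*` (Theorem 1.4 over the base field `F`)**, granted
Theorem 2.1, Lemma 2.2, Lemma 3.1 and the persistence of monomial forms: there are no regular
algebraic local rings `A'` of `K = F(u,v)` and `B'` of `L = F(x,y)` with `ν*` dominating `B'`,
`B'` dominating `A'`, `A'` dominating `A`, `B'` dominating `B` and `A' → B'` monomial.
[cite: Cutkosky2014, Thm. 1.4 and §3 (p. 7)] -/
theorem noWeakLocalMonomialization_F (hF : AbhyankarQuadraticFactorization.{u})
    (hU : AbhyankarQuadraticUnion.{u}) (hP : CutkoskyMonomialPersists.{u}) :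
    NoWeakLocalMonomialization F L (Kuv F p x y) (Vstar p hxy hgen h3 hL)
      (originLocalRing (algebraicIndependent_uv F p hgen hxy)) (originLocalRing hxy) := by
  rintro ⟨A', B', hle, hA', hB', hrA, hrB, hVB, hAB, hAA, hBB, hmono⟩
  -- `B' = B_l`
  have hBB0 : Dominates F L (Bring p hxy hgen h3 hL 0) B' := by rw [Bring_zero]; exact hBB
  obtain ⟨l, rfl⟩ := eq_Bring_of_dominated p hxy hgen h3 hL hF hU hB' hrB hVB hBB0
  -- `A' = A_m`
  have hVA : ValuationDominates F L (Vstar p hxy hgen h3 hL) A' :=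
    ⟨fun z hz => hVB.1 (hle hz), fun z hz hzinv => hAB.2 z hz (hVB.2 z (hle hz) hzinv)⟩
  have hAA0 : Dominates F L (Aring p hxy hgen h3 hL 0) A' := by rw [Aring_zero]; exact hAA
  obtain ⟨m, rfl⟩ := eq_Aring_of_dominated p hxy hgen h3 hL hF hU hA' hrA hVA hAA0
  -- `l = pi + j`, `0 ≤ j < p`
  have hl : l = p * (l / p) + l % p := (Nat.div_add_mod l p).symm
  have hj : l % p < p := Nat.mod_lt _ hp.out.pos
  -- `m ≤ pi`: otherwise `B_l` dominates the quadratic transform `A_{pi+1}` of `A_{pi}`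
  have hmpi : m ≤ p * (l / p) := by
    by_contra hlt
    have hle' : p * (l / p) + 1 ≤ m := by omega
    have hq := (Aring_succ p hxy hgen h3 hL (p * (l / p))).1
    have hdom : SubringDominates (Aring p hxy hgen h3 hL (p * (l / p) + 1)).toSubring
        (Bring p hxy hgen h3 hL (p * (l / p) + l % p)).toSubring := by
      rw [← hl]
      exact (Aring_dominates_of_le p hxy hgen h3 hL hle').trans hAB
    exact not_dominates_quadraticTransform p hxy hgen h3 hL (l / p) (l % p) hj _ hq hdom
  -- persistence of the monomial form up to `A_{pi}`, contradicting (C4)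
  have eB : Bring p hxy hgen h3 hL l = Bring p hxy hgen h3 hL (p * (l / p) + l % p) := by rw [← hl]
  have hmono' := isMonomialExtension_congr rfl eB hle
    (Aring_dominated_Bring p hxy hgen h3 hL (j := l % p) hmpi).1 hmono
  have key := isMonomialExtension_persists p hxy hgen h3 hL hP hmpi hmono' (p * (l / p)) hmpi le_rfl
  exact not_isMonomialExtension p hxy hgen h3 hL (l / p) (l % p) hj rfl rfl _ key

end Endgame

end Cutkosky

end Literature.Barriers.ResolutionOfSingularities

end
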